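import Summits.SmoothPoincare4.SmoothPoincare4.Theorems.SymplecticOrigamiGromovRecognitionRelEndLimitLeaf
import Summits.SmoothPoincare4.SmoothPoincare4.Theorems.SymplecticOrigamiGromovRecognitionRelEndLeafDisjoint
import Summits.SmoothPoincare4.SmoothPoincare4.Theorems.SymplecticOrigamiGromovRecognitionRelEndFoliationCoordinate
import Summits.SmoothPoincare4.SmoothPoincare4.Theorems.SymplecticOrigamiGromovRecognitionRelEndLamLocalU

/-!
# One Gromov–McDuff fibration of the wedge cap: the retraction `lam` along the leaves
(registered helper `helper_oneFoliation` (L8) of line `cross-cap-laurent`, crux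
`GromovRecognitionRelEnd`, item stmt-SmoothPoincare4-11009; the assembly of ONE fibration in the
glue of the bi-foliation)

Setting: the data `FoliationData ωX JX u₀ v₀ uH vH F₀ TH TV UH UV δ` of one foliation of the wedge
cap (`…GlueData`): the reference sphere `S₀ = (u₀, v₀)` with glued map `F₀`, the transverse wedge
sphere `S_H = (uH, vH)` with image `KH = pairImage uH vH = {y ∈ UH | TH y = 0}` (`zeroSetH`), and the
vendored facts F1 (`hls_localFoliation_embeddedSphere_trivialNormal`), F2
(`gromovCompactness_spheres_dichotomy`), F6 (`jSphere_wedgeCount_factorsThroughHomology`) and F4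
(`adjunction_embedded_of_somewhereInjective_sphere`) as HYPOTHESES.  The LEAVES are the embedded
`JX`-spheres `(u, v)` with a normal witness whose glued map is homotopic to `F₀`
(`IsLeafOf (fun y => JX y) F₀ u v`).

`helper_oneFoliation` builds the retraction `lam : X → X` of `X` onto `KH` along the leaves and
proves: `lam` is `C^∞`; `lam y ∈ KH`; `lam = id` on `KH`; `lam y = v₀ 0 ↔ y ∈ im S₀`;
`ker d lam_y` is `JX`-invariant; and through every `y` there is a leaf whose points are exactly the
fibre `{lam = lam y}` and whose tangent at `y` is `ker d lam_y`.

Proof (all ingredients are landed helpers of the line).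
* Meeting point.  A leaf `(u, v)` meets `KH` in exactly ONE point (`helper_leaf_meetsOnce`: one
  simple zero of `TH ∘ u` and `v 0 ∉ KH`, or no zero of `TH ∘ u` and `v 0 ∈ KH`), so
  `pairImage u v ∩ KH = {m}` (`OneFoliation.inter_wedge_eq_singleton`).  Every point lies on a leaf
  (`helper_leaf_cover`) and two leaves are equal or disjoint as point sets (`helper_leaf_disjoint`),
  so all leaves through `y` have the same image and the same meeting point `lam y`
  (`OneFoliation.exists_lam`: `pairImage u v ∩ KH = {lam y}` for EVERY leaf `(u, v) ∋ y`).  The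
  set-theoretic clauses follow: `lam y ∈ KH`; `y ∈ KH ⇒ lam y = y`; the fibre of the corner
  `v₀ 0 = KH ∩ im S₀` (`inter_eq`) is the reference leaf (`helper_leaf_ref`); points of one leaf have
  the same `lam`, and points with the same `lam` lie on leaves sharing that point, hence equal.
* Smoothness and kernel at `y₁` (`OneFoliation.local_structure`).  Around the leaf through `y₁`,
  `helper_leaf_chart` gives the family of LEAVES `(U a, V a)`, `‖a‖ < ε`, sweeping the open set `N`,
  and `helper_foliationCoordinate` its leaf coordinate `π` (smooth on `N`, `π = a` on the leaf `a`,
  `ker dπ` = leaf tangent).  The leaf `(U 0, V 0) ∋ y₁` meets `KH` simply, in the `U`-chart or at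
  `V 0 0` (`helper_leaf_meetsOnce`), so `LamLocal.exists_local_representative` (the engine of
  `helper_lamLocalU` / `helper_lamLocalV`) gives an open `O ∋ y₁` in `N` and `ℓ` smooth on `O` with
  `ℓ y ∈ KH` on the member leaf `π y` of `y` and `ker dℓ_y = ker dπ_y`.  That member leaf IS a leaf
  through `y`, so `ℓ y ∈ pairImage (U (π y)) (V (π y)) ∩ KH = {lam y}`: `lam = ℓ` on `O`.  Hence
  `lam` is `C^∞` at `y₁` (`ContMDiffAt.congr_of_eventuallyEq`), `d lam_{y₁} = dℓ_{y₁}`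
  (`Filter.EventuallyEq.mfderiv_eq`), and `d lam_{y₁} ξ = 0 ↔ dπ_{y₁} ξ = 0 ↔ ξ` is tangent to
  `(U 0, V 0)` at `y₁` (kernel clauses of the leaf coordinate).
* `JX`-invariance: `ker d lam_y` is the range of `d u_z` (`y = u z`) or of `d v_0` (`y = v 0`) for
  the `JX`-holomorphic leaf `(u, v)` through `y`, and `JX (du ζ) = du (i ζ)`.

References: M. Gromov, Invent. Math. 82 (1985), 2.4.A–2.4.A₁'; D. McDuff, J. Amer. Math. Soc. 3
(1990), §3–4; D. McDuff, D. Salamon, *J-holomorphic curves and symplectic topology*, 2nd ed.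
(2012), Thm. 9.4.7; C. Wendl, *Holomorphic Curves in Low Dimensions* (2018), Prop. 2.53.  No new
definitions, notation or instances.
-/

noncomputable section

open scoped Manifold ContDiff Topology
open Set Function Filter Literature.Topology.FourManifolds Literature.Topology.FourManifolds.ComplexProjectiveSpace
  Literature.Geometry.Kaehler Literature.Geometry.Symplectic Literature.AlgebraicTopology.SingularHomology

-- the prescribed namespace `Summit.<P>.<Sub>.…` duplicates `SmoothPoincare4` (P = Sub)
set_option linter.dupNamespace false

namespace Summit.SmoothPoincare4.SmoothPoincare4.Theorems.GromovRecognitionRelEnd.CrossCapLaurent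

namespace OneFoliation

variable {X : Type} [TopologicalSpace X] [ChartedSpace (EuclideanSpace ℝ (Fin 4)) X]
  [IsManifold (𝓡 4) ∞ X] {JX : AlmostComplexStructure (𝓡 4) ∞ X} {uH vH : ℂ → X}
  {F₀ : C(ComplexProjectiveSpace 1, X)}

/-! ### Consequences of the characterisation of `lam` -/

/-- `lam y` lies on every leaf through `y` and on the transverse wedge sphere. -/
theorem lam_mem {lam : X → X}
    (hlam : ∀ (y : X) (u v : ℂ → X), IsLeafOf (fun y => JX y) F₀ u v →
      y ∈ pairImage u v → pairImage u v ∩ pairImage uH vH = {lam y})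
    {y : X} {u v : ℂ → X} (hl : IsLeafOf (fun y => JX y) F₀ u v) (hy : y ∈ pairImage u v) :
    lam y ∈ pairImage u v ∧ lam y ∈ pairImage uH vH := by
  have h : lam y ∈ pairImage u v ∩ pairImage uH vH := by
    rw [hlam y u v hl hy]
    exact mem_singleton _
  exact h

/-- A point of a leaf through `y` lying on the transverse wedge sphere is `lam y`. -/
theorem eq_lam {lam : X → X}
    (hlam : ∀ (y : X) (u v : ℂ → X), IsLeafOf (fun y => JX y) F₀ u v →
      y ∈ pairImage u v → pairImage u v ∩ pairImage uH vH = {lam y})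
    {y m : X} {u v : ℂ → X} (hl : IsLeafOf (fun y => JX y) F₀ u v) (hy : y ∈ pairImage u v)
    (hm : m ∈ pairImage u v) (hmK : m ∈ pairImage uH vH) : m = lam y := by
  have h : m ∈ pairImage u v ∩ pairImage uH vH := ⟨hm, hmK⟩
  rw [hlam y u v hl hy] at h
  exact h

/-- Two points of one leaf have the same image under `lam`. -/
theorem lam_eq_of_mem {lam : X → X}
    (hlam : ∀ (y : X) (u v : ℂ → X), IsLeafOf (fun y => JX y) F₀ u v →
      y ∈ pairImage u v → pairImage u v ∩ pairImage uH vH = {lam y})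
    {y y' : X} {u v : ℂ → X} (hl : IsLeafOf (fun y => JX y) F₀ u v) (hy : y ∈ pairImage u v)
    (hy' : y' ∈ pairImage u v) : lam y' = lam y :=
  Set.singleton_eq_singleton_iff.1 ((hlam y' u v hl hy').symm.trans (hlam y u v hl hy))

variable [T2Space X] [SecondCountableTopology X] [CompactSpace X] [ConnectedSpace X]
  {ωX : MForm (𝓡 4) X ℝ 2} {u₀ v₀ : ℂ → X} {TH TV : X → ℂ} {UH UV : Set X} {δ : ℝ}

/-! ### The meeting point with the transverse wedge sphere -/

/-- **A leaf meets the transverse wedge sphere in exactly one point.**  For a leaf `(u, v)` of the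
family of `F₀`, `pairImage u v ∩ pairImage uH vH` is a singleton: by `helper_leaf_meetsOnce` the
leaf meets `{y ∈ UH | TH y = 0} = pairImage uH vH` (`zeroSetH`) either at a unique affine parameter
`z₀` and not at `v 0`, or at no affine parameter and at `v 0`. -/
theorem inter_wedge_eq_singleton (hfact : jSphere_wedgeCount_factorsThroughHomology)
    (D : FoliationData ωX JX u₀ v₀ uH vH F₀ TH TV UH UV δ) {u v : ℂ → X}
    (hl : IsLeafOf (fun y => JX y) F₀ u v) :
    ∃ m : X, pairImage u v ∩ pairImage uH vH = {m} := by
  have hK : ∀ y : X, y ∈ pairImage uH vH ↔ y ∈ UH ∧ TH y = 0 := fun y => by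
    rw [← D.zeroSetH]
    rfl
  rcases helper_leaf_meetsOnce X ωX JX u₀ v₀ uH vH F₀ TH TV UH UV δ hfact D u v hl with
    ⟨z₀, hz₀, huniq, hv0, -⟩ | ⟨hnone, hv0, -⟩
  · -- the meeting point is the affine point `u z₀`
    refine ⟨u z₀, Set.ext fun y => ⟨fun hy => ?_, fun hy => ?_⟩⟩
    · obtain ⟨hy, hyK⟩ := hy
      rw [hK] at hyK
      rcases (mem_pairImage_iff u v y).1 hy with ⟨z, rfl⟩ | rfl
      · rw [mem_singleton_iff, huniq z hyK]
      · exact absurd hyK hv0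
    · rw [mem_singleton_iff] at hy
      rw [hy]
      exact ⟨(mem_pairImage_iff u v _).2 (Or.inl ⟨z₀, rfl⟩), (hK _).2 hz₀⟩
  · -- the meeting point is the point at infinity `v 0`
    refine ⟨v 0, Set.ext fun y => ⟨fun hy => ?_, fun hy => ?_⟩⟩
    · obtain ⟨hy, hyK⟩ := hy
      rw [hK] at hyK
      rcases (mem_pairImage_iff u v y).1 hy with ⟨z, rfl⟩ | rfl
      · exact absurd hyK (hnone z)
      · exact mem_singleton _
    · rw [mem_singleton_iff] at hy
      rw [hy]
      exact ⟨(mem_pairImage_iff u v _).2 (Or.inr rfl), (hK _).2 hv0⟩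

/-- **The retraction `lam` and its characterisation.**  There is `lam : X → X` such that for EVERY
leaf `(u, v)` through `y`, `pairImage u v ∩ pairImage uH vH = {lam y}`: the meeting point of a leaf
through `y` (`helper_leaf_cover`, `inter_wedge_eq_singleton`) does not depend on the leaf, two
leaves through `y` having the same image (`helper_leaf_disjoint`). -/
theorem exists_lam (hF1 : hls_localFoliation_embeddedSphere_trivialNormal)
    (hF2 : gromovCompactness_spheres_dichotomy) (hfact : jSphere_wedgeCount_factorsThroughHomology)
    (hadj : adjunction_embedded_of_somewhereInjective_sphere)
    (D : FoliationData ωX JX u₀ v₀ uH vH F₀ TH TV UH UV δ) :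
    ∃ lam : X → X, ∀ (y : X) (u v : ℂ → X), IsLeafOf (fun y => JX y) F₀ u v →
      y ∈ pairImage u v → pairImage u v ∩ pairImage uH vH = {lam y} := by
  have h : ∀ y : X, ∃ m : X, ∀ (u v : ℂ → X), IsLeafOf (fun y => JX y) F₀ u v →
      y ∈ pairImage u v → pairImage u v ∩ pairImage uH vH = {m} := by
    intro y
    obtain ⟨u, v, hl, hy⟩ :=
      helper_leaf_cover X ωX JX u₀ v₀ uH vH F₀ TH TV UH UV δ hF1 hF2 hfact hadj D y
    obtain ⟨m, hm⟩ := inter_wedge_eq_singleton hfact D hl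
    refine ⟨m, fun u' v' hl' hy' => ?_⟩
    rcases helper_leaf_disjoint X JX F₀ hF1 u' v' u v hl' hl with h | h
    · rw [h]
      exact hm
    · exact (Set.disjoint_left.1 h hy' hy).elim
  choose lam hlam using h
  exact ⟨lam, hlam⟩

/-- Points with the same image under `lam` lie on the same leaves: the leaf through `y` and the
leaf through `y'` share the point `lam y = lam y'`, so they are equal (`helper_leaf_disjoint`). -/
theorem mem_of_lam_eq (hF1 : hls_localFoliation_embeddedSphere_trivialNormal) {lam : X → X}
    (hlam : ∀ (y : X) (u v : ℂ → X), IsLeafOf (fun y => JX y) F₀ u v →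
      y ∈ pairImage u v → pairImage u v ∩ pairImage uH vH = {lam y})
    {y y' : X} {u v u' v' : ℂ → X} (hl : IsLeafOf (fun y => JX y) F₀ u v)
    (hy : y ∈ pairImage u v) (hl' : IsLeafOf (fun y => JX y) F₀ u' v')
    (hy' : y' ∈ pairImage u' v') (he : lam y' = lam y) : y' ∈ pairImage u v := by
  rcases helper_leaf_disjoint X JX F₀ hF1 u v u' v' hl hl' with h | h
  · rw [h]
    exact hy'
  · exact (Set.disjoint_left.1 h (lam_mem hlam hl hy).1 (he ▸ (lam_mem hlam hl' hy').1)).elim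

/-- **Local structure of `lam`.**  Around `y₁`, `lam` agrees with the smooth local representative
`ℓ` (`LamLocal.exists_local_representative`, the engine of `helper_lamLocalU` / `helper_lamLocalV`)
built from the family of leaves `(U a, V a)`, `‖a‖ < ε`, of `helper_leaf_chart` around the leaf
through `y₁`, its leaf coordinate `π` (`helper_foliationCoordinate`) and the simple meeting point
of the leaf `(U 0, V 0) ∋ y₁` with the transverse wedge sphere (`helper_leaf_meetsOnce`): indeed
`ℓ y` lies on the member leaf `π y` through `y` and on the wedge sphere, so `ℓ y = lam y`.  Hence
`lam` is `C^∞` at `y₁` and `d lam_{y₁} ξ = 0 ↔ dπ_{y₁} ξ = 0 ↔ ξ` is tangent to `(U 0, V 0)`. -/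
theorem local_structure (hF1 : hls_localFoliation_embeddedSphere_trivialNormal)
    (hF2 : gromovCompactness_spheres_dichotomy) (hfact : jSphere_wedgeCount_factorsThroughHomology)
    (hadj : adjunction_embedded_of_somewhereInjective_sphere)
    (D : FoliationData ωX JX u₀ v₀ uH vH F₀ TH TV UH UV δ) {lam : X → X}
    (hlam : ∀ (y : X) (u v : ℂ → X), IsLeafOf (fun y => JX y) F₀ u v →
      y ∈ pairImage u v → pairImage u v ∩ pairImage uH vH = {lam y}) (y₁ : X) :
    ∃ u v : ℂ → X, IsLeafOf (fun y => JX y) F₀ u v ∧ y₁ ∈ pairImage u v ∧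
      ContMDiffAt (𝓡 4) (𝓡 4) ∞ lam y₁ ∧
      (∀ z : ℂ, u z = y₁ → ∀ ξ : TangentSpace (𝓡 4) y₁,
        mfderiv (𝓡 4) (𝓡 4) lam y₁ ξ = 0 ↔ ξ ∈ range (mfderiv 𝓘(ℝ, ℂ) (𝓡 4) u z)) ∧
      (v 0 = y₁ → ∀ ξ : TangentSpace (𝓡 4) y₁,
        mfderiv (𝓡 4) (𝓡 4) lam y₁ ξ = 0 ↔ ξ ∈ range (mfderiv 𝓘(ℝ, ℂ) (𝓡 4) v 0)) := by
  -- the leaf through `y₁` and the family of leaves `(U a, V a)`, `‖a‖ < ε`, around it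
  obtain ⟨u, v, hl, hy₁⟩ :=
    helper_leaf_cover X ωX JX u₀ v₀ uH vH F₀ TH TV UH UV δ hF1 hF2 hfact hadj D y₁
  obtain ⟨ε, U, V, hε, hU0, hV0, hleaf, hUs, hVs, hdisj, hinj, hopen⟩ :=
    helper_leaf_chart X JX F₀ hF1 hadj u v hl
  obtain rfl : U 0 = u := funext hU0
  obtain rfl : V 0 = v := funext hV0
  have h0 : ‖(0 : ℂ)‖ < ε := by simpa using hε
  -- its leaf coordinate `π`
  obtain ⟨π, hπs, -, hπU, hπV, -, hkerU, hkerV⟩ := helper_foliationCoordinate X ε U V hε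
    (fun a ha => ⟨(hleaf a ha).sphere.smooth_u, (hleaf a ha).sphere.smooth_v,
      (hleaf a ha).sphere.compat, (hleaf a ha).embedded.injective, (hleaf a ha).embedded.imm_u,
      (hleaf a ha).embedded.imm_v, (hleaf a ha).embedded.infty_notMem⟩) hUs hVs hdisj hinj hopen
  have hy₁N : y₁ ∈ ⋃ a ∈ Metric.ball (0 : ℂ) ε, (range (U a) ∪ {V a 0}) :=
    mem_iUnion₂.2 ⟨0, Metric.mem_ball_self hε, hy₁⟩
  have hπy₁ : π y₁ = 0 := by
    rcases (mem_pairImage_iff _ _ _).1 hy₁ with ⟨z, hz⟩ | h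
    · rw [← hz]
      exact hπU 0 h0 z
    · rw [h]
      exact hπV 0 h0 0
  -- every point `y` of the swept set lies on the member leaf `π y`, `‖π y‖ < ε`
  have hN : ∀ y ∈ ⋃ a ∈ Metric.ball (0 : ℂ) ε, (range (U a) ∪ {V a 0}),
      ‖π y‖ < ε ∧ y ∈ pairImage (U (π y)) (V (π y)) := by
    intro y hy
    obtain ⟨a, ha, hya⟩ := mem_iUnion₂.1 hy
    have ha' : ‖a‖ < ε := mem_ball_zero_iff.1 ha
    have hπy : π y = a := by
      rcases hya with ⟨z, rfl⟩ | h
      · exact hπU a ha' z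
      · rw [mem_singleton_iff.1 h]
        exact hπV a ha' 0
    rw [hπy]
    exact ⟨ha', hya⟩
  -- a point of the member leaf of `y` on `{y ∈ UH | TH y = 0}` is `lam y`
  have hmember : ∀ y ∈ ⋃ a ∈ Metric.ball (0 : ℂ) ε, (range (U a) ∪ {V a 0}), ∀ m : X,
      m ∈ pairImage (U (π y)) (V (π y)) → m ∈ UH ∧ TH m = 0 → m = lam y := by
    intro y hy m hm hmK
    have hmK' : m ∈ pairImage uH vH := by
      rw [← D.zeroSetH]
      exact hmK
    exact eq_lam hlam (hleaf _ (hN y hy).1) (hN y hy).2 hm hmK'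
  -- the smooth local representative `ℓ` of `lam` near `y₁`
  obtain ⟨O, ℓ, hO, hy₁O, hℓs, hℓlam, hℓker⟩ : ∃ (O : Set X) (ℓ : X → X), IsOpen O ∧ y₁ ∈ O ∧
      ContMDiffOn (𝓡 4) (𝓡 4) ∞ ℓ O ∧ (∀ y ∈ O, ℓ y = lam y) ∧
      (∀ y ∈ O, ∀ ξ : TangentSpace (𝓡 4) y,
        mfderiv (𝓡 4) (𝓡 4) ℓ y ξ = 0 ↔ mfderiv (𝓡 4) 𝓘(ℝ, ℂ) π y ξ = 0) := by
    rcases helper_leaf_meetsOnce X ωX JX u₀ v₀ uH vH F₀ TH TV UH UV δ hfact D (U 0) (V 0)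
        (hleaf 0 h0) with ⟨z₀, ⟨hz₀U, hz₀T⟩, -, -, hderiv⟩ | ⟨-, ⟨hv0U, hv0T⟩, hderiv⟩
    · -- the leaf through `y₁` meets the wedge sphere in its affine chart, simply
      obtain ⟨O, ℓ, hO, hy₁O, hON, hℓs, hℓval, hℓker⟩ :=
        LamLocal.exists_local_representative (fun y => JX y) (W := U) D.coordH.isOpen
          D.coordH.smooth D.coordH.hol hε (hleaf 0 h0).sphere.smooth_u (hleaf 0 h0).sphere.hol_u
          hUs (fun q hq => (hinj q hq).1) hopen hπs hy₁N hπy₁ hz₀U hz₀T hderiv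
      refine ⟨O, ℓ, hO, hy₁O, hℓs, fun y hy => ?_, hℓker⟩
      obtain ⟨hyU, hyT, z, hz⟩ := hℓval y hy
      exact hmember y (hON hy) (ℓ y) ((mem_pairImage_iff _ _ _).2 (Or.inl ⟨z, hz.symm⟩))
        ⟨hyU, hyT⟩
    · -- the leaf through `y₁` meets the wedge sphere at its point at infinity, simply
      obtain ⟨O, ℓ, hO, hy₁O, hON, hℓs, hℓval, hℓker⟩ :=
        LamLocal.exists_local_representative (fun y => JX y) (W := V) D.coordH.isOpen
          D.coordH.smooth D.coordH.hol hε (hleaf 0 h0).sphere.smooth_v (hleaf 0 h0).sphere.hol_v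
          hVs (fun q hq => (hinj q hq).2) hopen hπs hy₁N hπy₁ hv0U hv0T hderiv
      refine ⟨O, ℓ, hO, hy₁O, hℓs, fun y hy => ?_, hℓker⟩
      obtain ⟨hyU, hyT, w, hw⟩ := hℓval y hy
      refine hmember y (hON hy) (ℓ y) ((mem_pairImage_iff _ _ _).2 ?_) ⟨hyU, hyT⟩
      by_cases hw0 : w = 0
      · exact Or.inr (by rw [hw, hw0])
      · exact Or.inl ⟨w⁻¹, by rw [hw, (hleaf _ (hN y (hON hy)).1).sphere.compat w hw0]⟩
  -- `lam = ℓ` near `y₁`: smoothness and differential of `lam` at `y₁`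
  have hev : lam =ᶠ[𝓝 y₁] ℓ :=
    Filter.eventuallyEq_of_mem (hO.mem_nhds hy₁O) fun y hy => (hℓlam y hy).symm
  have hat : ContMDiffAt (𝓡 4) (𝓡 4) ∞ lam y₁ :=
    (hℓs.contMDiffAt (hO.mem_nhds hy₁O)).congr_of_eventuallyEq hev
  have hker : ∀ ξ : TangentSpace (𝓡 4) y₁,
      mfderiv (𝓡 4) (𝓡 4) lam y₁ ξ = 0 ↔ mfderiv (𝓡 4) 𝓘(ℝ, ℂ) π y₁ ξ = 0 := fun ξ => by
    rw [hev.mfderiv_eq]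
    exact hℓker y₁ hy₁O ξ
  refine ⟨U 0, V 0, hleaf 0 h0, hy₁, hat, fun z hz ξ => ?_, fun hv ξ => ?_⟩
  · subst hz
    exact (hker ξ).trans (hkerU 0 h0 z ξ)
  · subst hv
    exact (hker ξ).trans (hkerV 0 h0 0 ξ)

end OneFoliation

/-- **L8 (registered helper `helper_oneFoliation`): one Gromov–McDuff fibration of the wedge cap.**
With the foliation data and the facts F1, F2, F6, F4 as hypotheses, there is a retraction
`lam : X → X` of `X` onto the transverse wedge sphere `pairImage uH vH` along the leaves of the
family of `F₀` (`lam y` = the point where the leaf through `y` meets the wedge sphere,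
`OneFoliation.exists_lam`): `lam` is `C^∞` (locally it is the smooth representative of
`helper_lamLocalU` / `helper_lamLocalV`, `OneFoliation.local_structure`), takes values on the wedge
sphere and fixes it pointwise, its fibre over the corner `v₀ 0` is the reference sphere, the kernels
`ker d lam_y` are `JX`-invariant, and through every `y` passes a leaf `(u, v)` whose points are
exactly the fibre `{y' | lam y' = lam y}` and whose tangent at `y` is `ker d lam_y`. -/
theorem helper_oneFoliation : ∀ (X : Type) [TopologicalSpace X] [T2Space X]
    [SecondCountableTopology X] [CompactSpace X] [ConnectedSpace X]
    [ChartedSpace (EuclideanSpace ℝ (Fin 4)) X] [IsManifold (𝓡 4) ∞ X] (ωX : MForm (𝓡 4) X ℝ 2)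
    (JX : AlmostComplexStructure (𝓡 4) ∞ X) (u₀ v₀ uH vH : ℂ → X)
    (F₀ : C(ComplexProjectiveSpace 1, X)) (TH TV : X → ℂ) (UH UV : Set X) (δ : ℝ),
    hls_localFoliation_embeddedSphere_trivialNormal → gromovCompactness_spheres_dichotomy →
    jSphere_wedgeCount_factorsThroughHomology → adjunction_embedded_of_somewhereInjective_sphere →
    FoliationData ωX JX u₀ v₀ uH vH F₀ TH TV UH UV δ →
    ∃ lam : X → X,
      ContMDiff (𝓡 4) (𝓡 4) ∞ lam ∧
      (∀ y, lam y ∈ pairImage uH vH) ∧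
      (∀ y ∈ pairImage uH vH, lam y = y) ∧
      (∀ y, lam y = v₀ 0 ↔ y ∈ pairImage u₀ v₀) ∧
      (∀ (y : X) (ξ : TangentSpace (𝓡 4) y), mfderiv (𝓡 4) (𝓡 4) lam y ξ = 0 →
        mfderiv (𝓡 4) (𝓡 4) lam y (JX y ξ) = 0) ∧
      (∀ y : X, ∃ u v : ℂ → X, IsLeafOf (fun y => JX y) F₀ u v ∧ y ∈ pairImage u v ∧
        (∀ y' : X, y' ∈ pairImage u v ↔ lam y' = lam y) ∧
        (∀ z : ℂ, u z = y → ∀ ξ : TangentSpace (𝓡 4) y,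
          mfderiv (𝓡 4) (𝓡 4) lam y ξ = 0 ↔ ξ ∈ range (mfderiv 𝓘(ℝ, ℂ) (𝓡 4) u z)) ∧
        (v 0 = y → ∀ ξ : TangentSpace (𝓡 4) y,
          mfderiv (𝓡 4) (𝓡 4) lam y ξ = 0 ↔ ξ ∈ range (mfderiv 𝓘(ℝ, ℂ) (𝓡 4) v 0))) := by
  intro X _ _ _ _ _ _ _ ωX JX u₀ v₀ uH vH F₀ TH TV UH UV δ hF1 hF2 hfact hadj D
  obtain ⟨lam, hlam⟩ := OneFoliation.exists_lam hF1 hF2 hfact hadj D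
  have cover := helper_leaf_cover X ωX JX u₀ v₀ uH vH F₀ TH TV UH UV δ hF1 hF2 hfact hadj D
  refine ⟨lam, fun y => ?_, fun y => ?_, fun y hy => ?_, fun y => ?_, fun y ξ hξ => ?_,
    fun y => ?_⟩
  · -- `lam` is smooth: it is smooth at every point
    obtain ⟨-, -, -, -, h, -⟩ := OneFoliation.local_structure hF1 hF2 hfact hadj D hlam y
    exact h
  · -- `lam` takes values on the transverse wedge sphere
    obtain ⟨u, v, hl, hy⟩ := cover y
    exact (OneFoliation.lam_mem hlam hl hy).2
  · -- `lam` is the identity on the transverse wedge sphere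
    obtain ⟨u, v, hl, hy'⟩ := cover y
    exact (OneFoliation.eq_lam hlam hl hy' hy' hy).symm
  · -- the fibre of the corner `v₀ 0` is the reference sphere, a leaf
    have href := helper_leaf_ref X ωX JX u₀ v₀ uH vH F₀ TH TV UH UV δ D
    have hc : v₀ 0 ∈ pairImage uH vH ∩ pairImage u₀ v₀ := by
      rw [D.inter_eq]
      exact mem_singleton _
    have hc' : lam (v₀ 0) = v₀ 0 := (OneFoliation.eq_lam hlam href hc.2 hc.2 hc.1).symm
    constructor
    · intro he
      obtain ⟨u, v, hl, hy⟩ := cover y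
      exact OneFoliation.mem_of_lam_eq hF1 hlam href hc.2 hl hy (he.trans hc'.symm)
    · intro hy
      exact (OneFoliation.eq_lam hlam href hy hc.2 hc.1).symm
  · -- `ker d lam_y` is the tangent of the `JX`-holomorphic leaf through `y`: `JX`-invariant
    obtain ⟨u, v, hl, hy, -, hkU, hkV⟩ := OneFoliation.local_structure hF1 hF2 hfact hadj D hlam y
    rcases (mem_pairImage_iff u v y).1 hy with ⟨z, hz⟩ | hv
    · subst hz
      obtain ⟨ζ, rfl⟩ := (hkU z rfl ξ).1 hξ
      exact (hkU z rfl _).2 ⟨_, hl.sphere.hol_u z ζ⟩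
    · subst hv
      obtain ⟨ζ, rfl⟩ := (hkV rfl ξ).1 hξ
      exact (hkV rfl _).2 ⟨_, hl.sphere.hol_v 0 ζ⟩
  · -- the leaf through `y`: its points are the fibre of `lam y`, its tangent is `ker d lam_y`
    obtain ⟨u, v, hl, hy, -, hkU, hkV⟩ := OneFoliation.local_structure hF1 hF2 hfact hadj D hlam y
    refine ⟨u, v, hl, hy, fun y' => ⟨fun hy' => ?_, fun he => ?_⟩, hkU, hkV⟩
    · exact OneFoliation.lam_eq_of_mem hlam hl hy hy'
    · obtain ⟨u', v', hl', hy'⟩ := cover y'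
      exact OneFoliation.mem_of_lam_eq hF1 hlam hl hy hl' hy' he

end Summit.SmoothPoincare4.SmoothPoincare4.Theorems.GromovRecognitionRelEnd.CrossCapLaurent

end
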